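import Literature.NumberTheory.GaloisRepresentations.IdeleTruncatedSLocalInjectivityTwo
import Literature.NumberTheory.GaloisRepresentations.IdeleTruncatedSLocalLayerComponents
import HarnessLib

/-!
# [P2-mono] UNCONDITIONAL for a totally complex base field: a class of `H²(U, Ī_S)` all of whose conjugated local
# pull-backs vanish is zero (Harari Prop. 17.25 / Milne ADT I Lemma 4.13 at `r = 2`, injectivity half)

Topic `NumberTheory/GaloisRepresentations`; namespace `Literature.NumberTheory.GaloisRepresentations.IdeleReadout`.
One theorem; NO named fact, no `sorry`, no instance, no notation; number fields in `Type`.  Closes P2-e/f of the [P2-mono] plan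
`P2-MONO-SCOPING-w3g18-v2.md` (lane «PT-Ш-S-TC» of crux `stmt-BirchSwinnertonDyer-19032`, cell bsd-eis; LEAD bsd-line-x1-p1 g11):
`IdeleTruncatedSLocalInjectivityTwo.p2mono_of_finite` (LEAD g11: [P2-mono] FROM the finite-level statement) with its hypothesis
DISCHARGED by bsd-eis -w8 g13's `IdeleClassBar.eq_zero_of_forall_locLayerClass_eq_zero` (`IdeleTruncatedSLocalLayerComponents`: Tate,
C–F VII §7.3 over `E^{H}` + the retract `J_{E,S} ↪ J_E` + the `(w,t) ↔ u` square through -w3 g19's local layer/completion isomorphism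
and -w7 g14's places/double-cosets correspondence; `K` totally complex so that the archimedean components vanish).

* **`p2mono`** — [P2-mono] in the VERBATIM binder of -w4 g20's `idLocMap_injective_two_of_inputs''` (E4e) / of the `hP2` hypothesis of
  `Summit.….Theorems.PoitouTateShaNaturalAtOfP2mono.forall_natural_at_of_P2mono` (-w2 g12), for `K` totally complex and every open
  normal `U ≤ G_S`.

HONEST FRAMING: assembly of landed bricks; no case of Poitou–Tate duality and nothing about BSD is proved IN THIS FILE (the consumer
`Theorems/EisensteinPrimesPoitouTateShaNaturalAtTC` draws the duality).  AI formalisation, established only by the kernel check.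

## References
* D. Harari, *Galois Cohomology and Class Field Theory*, Universitext (2020), §17.5 Lemma 17.23, Prop. 17.25. [Harari2020]
* J. S. Milne, *Arithmetic Duality Theorems*, 2nd ed. (2006), I Lemma 4.13, I Thm. 4.10 (a) (proof, p. 58). [MilneADT2006]
* J. W. S. Cassels, A. Fröhlich (eds.), *Algebraic Number Theory* (1967), Ch. VII (J. Tate) §7.3 Prop. 7.3. [CasselsFrohlichANT1967]
-/

noncomputable section

open NumberField IsDedekindDomain Field CategoryTheory CategoryTheory.Limits CategoryTheory.Abelian
open Literature.Algebra.Homology Literature.Algebra.Homology.DiscreteRep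
open scoped Classical

namespace Literature.NumberTheory.GaloisRepresentations

namespace IdeleReadout

open IdeleClassBar DiscreteGaloisModule

variable (K : Type) [Field K] [NumberField K] [IsTotallyComplex K] (S : Finset (HeightOneSpectrum (𝓞 K)))
  (U : Subgroup (GaloisGroupUnramifiedOutside K (↑S : Set (HeightOneSpectrum (𝓞 K))))) [hUn : U.Normal]

/-- **[P2-mono] for `K` totally complex**: a class `y ∈ H²(U, Ī_S)` (`U ≤ G_S` open normal) all of whose conjugated local
pull-backs to `H²(φ_w⁻¹U, K̄_wˣ)` (`w ∣ S ∪ ∞`, one double-coset representative per place of `K_S^U` over `w`) vanish is zero —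
`p2mono_of_finite` with the finite-level input `IdeleClassBar.eq_zero_of_forall_locLayerClass_eq_zero`.
[cite: Harari2020, §17.5 Prop. 17.25][cite: MilneADT2006, I Lemma 4.13, I Thm. 4.10 (a) (proof, p. 58)]
[cite: CasselsFrohlichANT1967, Ch. VII §7.3 Prop. 7.3] -/
theorem p2mono
    (hU : IsOpen (U : Set (GaloisGroupUnramifiedOutside K (↑S : Set (HeightOneSpectrum (𝓞 K))))))
    (y : Ext (triv (k := ℤ) (Γ := ↥U) ℤ) ((resD ℤ U).obj (truncIdeleBarD K S)) 2)
    (hy : ∀ (w : OverS K S) (t : DoubleCosets (decompMapPlaceS K S w.1) U),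
      (y.mapExactFunctor (resDHom ℤ (conjHom (decompMapPlaceS K S w.1) U (dcRep (decompMapPlaceS K S w.1) U t))
        (continuous_conjHom (decompMapPlaceS K S w.1) (continuous_decompMapPlaceS K S w.1) U
          (dcRep (decompMapPlaceS K S w.1) U t)))).comp
        (Ext.mk₀ (conjCoeff (decompMapPlaceS K S w.1) (continuous_decompMapPlaceS K S w.1) U
          (truncIdeleBarD K S) (unitsD (Place.Completion w.1)) (locQ K S w) (dcRep (decompMapPlaceS K S w.1) U t)
          (k := ℤ))) (add_zero 2) = 0) :
    y = 0 :=
  p2mono_of_finite K S U hU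
    (fun E hE hEU c h => IdeleClassBar.eq_zero_of_forall_locLayerClass_eq_zero S U E hE hEU c h) y hy

end IdeleReadout

end Literature.NumberTheory.GaloisRepresentations

end
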